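import Literature.NumberTheory.Automorphic.SelfDualStableLatticeDepthCountRamified        -- ★ R2-C (A-p01): ramified level ∕ exact-depth counts, normalised diagonal frame
import Literature.NumberTheory.Automorphic.SelfDualStableLatticeDepthCountCM              -- ★ A-p13: `coe_inv_mul_mul_eq_of_eigenframe`, CM carriers (`placeForm_antidiagTwo_*`), transport
import Literature.NumberTheory.Automorphic.RamifiedPlaceAntiFixedUniformizer              -- ★ F0P3a-p04 (r0): anti-fixed uniformiser, `odd_log_valued_of_galAdicCompletionMap_eq_neg`
import Literature.NumberTheory.Automorphic.RamifiedPlaceIntegerInvolution              -- ★ A-p19 (g23) R-0c: `exists_integer_involution_complexConj_of_ramified` (the ramified `σO` package)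
import Literature.NumberTheory.Automorphic.ValuedFieldValuativeRelBridge                  -- ★ `v_eq_one_iff_valuation_eq_one`, `isUniformizingElement_of_v_eq`, DVR bridge
import HarnessLib

/-!
# DEPTH COUNTS AT A TAMELY RAMIFIED CM PLACE, I (road «R1-ram», brick R-2 FILE R2-D «FRAMES»): generic frame transport of the ramified level ∕ exact-depth counts, and at
# `w`: the ramified discharge package, «σ_w-fixed elements have EVEN order», and the rescaling of an eigenframe to a DIAGONAL UNIT Gram matrix
(Labesse–Langlands 1979, §2 p. 8; Jacobowitz 1962, §5, §7–§8; Kottwitz 1988, §2; Rogawski 1990, §3.5)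

Topic `NumberTheory/Automorphic`; namespaces `Literature.NumberTheory.Automorphic` (§0, generic frames) and `Literature.NumberTheory.Automorphic.UnitaryGroup` (§1 at `w`, as ★ A-p13
`SelfDualStableLatticeDepthCountCM`).  THEOREMS ONLY (no definition, no instance, no notation, no named fact, no `sorry`).  Cell `pub/hodgecm-mathlib` (D-0151), crux H413 =
`stmt-HodgeConjecture-24833`, road «R1-ram» (MEMO-R1ram §4; architect A-p16 (g27) RULINGS A-15 (b) ∕ A-17 (a): «the R-5b assembler consumes R2-D»), hand A-p01 (g21); FILE R2-E
(`…RamifiedCM`) states the heads at `(Φ₂)_w` over this file.  HONEST LABEL: HC_CM is proved only modulo the printed citations (hLiu418, h413) until rung 0 closes; nothing printed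
is a letter here — lattice counting at one completed place.

SETTING.  §0: `F` with `[ValuativeRel F]` as in ★ R2-C, a frame `Q` with `formCongr σ Q J = ϖ^{−d} • diag h` (`|h i| = 1`, `σ h = h`, `d ∈ {0,1}`) and `Q⁻¹γQ = diag(a, c)`.  §1: `L` CM, `v` a
finite place of `L⁺` NON-SPLIT (`c • w = w`) and RAMIFIED in `L` (`e(w|v) ≠ 1`), `|2|_w = 1` (tame); `σ_w := galAdicCompletionMap c hw`.
* §0 `map_sub_smul_one_le_pow_zero_of_map_eq` (level `0` is automatic for a `γ`-stable lattice), **`finite_and_ncard_selfDualStable_of_diagonal_frame`**: `S(J, γ)` is FINITE,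
  `#{Λ ∈ S(J, γ) | (γ − c·1)Λ ≤ ϖ^iΛ} = Σ_{j ≤ N, j ≡ d (2), j + i ≤ N} m q j` and `#{exact level i} = [i ≤ N ∧ N − i ≡ d]·m q (N − i)` (`m q 0 = 1`, `m q j = 2q^{⌊j∕2⌋}`) — ★ A-p13
  `ncard_selfDualStable_level_congr` ∕ `finite_selfDualStable_of_congr` + ★ R2-C.
* §1 (the `σO` package is ★ A-p19 `exists_integer_involution_complexConj_of_ramified`, imported) **`even_log_valued_of_galAdicCompletionMap_eq_of_ramified`** (σ_w-fixed ⇒ EVEN order, from ★ p04 `odd_log_valued_of_galAdicCompletionMap_eq_neg`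
  applied to `ϖ r`); `exists_valued_map_mul_mul_eq_one_of_ramified`; **`exists_rescaling_formCongr_eq_diagonal_of_ramified`**: `ᵗσ_w(P D) J (P D) = diag h`, `v_w(hᵢ) = 1`, `σ_w hᵢ = hᵢ`,
  `h₀h₁ = σ_w(det(PD))·det J·det(PD)` — NO parity bit survives (contrast ★ inert `exists_rescaling_formCongr_eq_uniformizer_pow_smul_one`).

## References
* [LabesseLanglands1979] J.-P. Labesse, R. P. Langlands, *L-indistinguishability for SL(2)*, Canad. J. Math. 31 (1979), §2 p. 8.
* [Jacobowitz1962] R. Jacobowitz, *Hermitian forms over local fields*, Amer. J. Math. 84 (1962), §5, §7–§8.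
* [Kottwitz1988] R. E. Kottwitz, *Tamagawa numbers*, Ann. of Math. 127 (1988), §2.
* [Rogawski1990] J. D. Rogawski, *Automorphic Representations of Unitary Groups in Three Variables* (1990), §3.5 p. 29, §4.9 Lemma 4.9.3 p. 56.
-/

set_option autoImplicit false

noncomputable section

open NumberField IsDedekindDomain Matrix Finset ValuativeRel IsLocalRing
open scoped ValuativeRel Matrix MatrixGroups

namespace Literature.NumberTheory.Automorphic

/-! ## §0 Generic frame lemmas: the counts read through a rescaled eigenframe `Q` with Gram matrix `ϖ^{−d} • diag h` -/

section OfFrame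

variable {F : Type*} [Field F] [ValuativeRel F] (σ : F →+* F) {ϖ : F} (hϖ : IsUniformizingElement ϖ)
  (σO : 𝒪[F] →+* 𝒪[F]) (hσO' : ∀ x : 𝒪[F], ((σO x : 𝒪[F]) : F) = σ x) (hσσ : ∀ x, σO (σO x) = x)
  (hres : ∀ x : 𝒪[F], σO x - x ∈ maximalIdeal 𝒪[F]) (h2 : IsUnit (2 : 𝒪[F])) (hσϖ : σ ϖ = -ϖ)
  {h : Fin 2 → F} (hh0 : valuation F (h 0) = 1) (hh1 : valuation F (h 1) = 1) (hσh : ∀ i, σ (h i) = h i)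
  (r : 𝒪[F]) (hr : h 0 * (r : F) = -h 1) (hsq : IsSquare (residue 𝒪[F] r)) {d : ℕ} (hd : d ≤ 1)
  {a c : F} {N : ℕ} (J : Matrix (Fin 2) (Fin 2) F) (γ Q : GL (Fin 2) F)
  (hQγ : ((Q⁻¹ * γ * Q : GL (Fin 2) F) : Matrix (Fin 2) (Fin 2) F) = !![a, 0; 0, c])
  (ha : valuation F a = 1) (hc : valuation F c = 1) (hN : valuation F (a - c) = valuation F (ϖ ^ N))
  (hform : formCongr σ Q J = ϖ ^ (-(d : ℤ)) • Matrix.diagonal h)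

include hc in
/-- **Level `0` is automatic**: a `γ′`-stable lattice `Λ` satisfies `(γ′ − c·1)Λ ≤ ϖ^0·Λ` for `|c| = 1` (`Λ` is an `𝒪`-module). [cite: Kottwitz1988, §2] -/
theorem map_sub_smul_one_le_pow_zero_of_map_eq (γ' : GL (Fin 2) F) (Λ : Submodule 𝒪[F] (Fin 2 → F))
    (hΛ : Λ.map ((Matrix.toLin' (γ' : Matrix (Fin 2) (Fin 2) F)).restrictScalars 𝒪[F]) = Λ) :
    Λ.map ((Matrix.toLin' ((γ' : Matrix (Fin 2) (Fin 2) F) - c • (1 : Matrix (Fin 2) (Fin 2) F))).restrictScalars 𝒪[F]) ≤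
      Λ.map ((Matrix.toLin' (ϖ ^ 0 • (1 : Matrix (Fin 2) (Fin 2) F))).restrictScalars 𝒪[F]) := by
  have hcO : c ∈ 𝒪[F] := (Valuation.mem_integer_iff _ _).2 hc.le
  have hid : Λ.map ((Matrix.toLin' (ϖ ^ 0 • (1 : Matrix (Fin 2) (Fin 2) F))).restrictScalars 𝒪[F]) = Λ := by
    have e : (Matrix.toLin' (ϖ ^ 0 • (1 : Matrix (Fin 2) (Fin 2) F))).restrictScalars 𝒪[F] = LinearMap.id := by
      apply LinearMap.ext; intro x; simp
    rw [e, Submodule.map_id]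
  rw [hid, Submodule.map_le_iff_le_comap]
  intro x hx
  rw [Submodule.mem_comap, LinearMap.restrictScalars_apply, Matrix.toLin'_apply, Matrix.sub_mulVec, Matrix.smul_mulVec, Matrix.one_mulVec]
  refine Λ.sub_mem ?_ ?_
  · rw [← hΛ]; exact Submodule.mem_map_of_mem (f := (Matrix.toLin' (γ' : Matrix (Fin 2) (Fin 2) F)).restrictScalars 𝒪[F]) hx
  · exact Λ.smul_mem (⟨c, hcO⟩ : 𝒪[F]) hx

include hϖ hσO' hσσ hres h2 hσϖ hh0 hh1 hσh hr hsq hd hQγ ha hc hN hform in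
/-- **THE COUNTS THROUGH A FRAME** (`formCongr σ Q J = ϖ^{−d} • diag h`, `Q⁻¹γQ = diag(a, c)`): `S(J, γ)` is FINITE, its level-`i` subset has
`ncard = Σ_{j ≤ N, j ≡ d (2), j + i ≤ N} m q j`, and its EXACT-level-`i` subset has `ncard = [i ≤ N ∧ N − i ≡ d (2)] · m q (N − i)` (`m q 0 = 1`, `m q j = 2q^{⌊j∕2⌋}`) — ★ A-p13 transport
`ncard_selfDualStable_level_congr` ∕ `finite_selfDualStable_of_congr` + ★ R2-C + `Set.ncard_diff`. [cite: Kottwitz1988, §2] [cite: LabesseLanglands1979, §2 p. 8] -/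
theorem finite_and_ncard_selfDualStable_of_diagonal_frame [IsDiscreteValuationRing 𝒪[F]] [Finite (ResidueField 𝒪[F])] {q : ℕ}
    (hq : Nat.card (ResidueField 𝒪[F]) = q) (i : ℕ) :
    {Λ : Submodule 𝒪[F] (Fin 2 → F) |
        (∃ g : GL (Fin 2) F, (∃ J' ∈ glInt 2 F, (J' : Matrix (Fin 2) (Fin 2) F) = formCongr σ g J) ∧
            Λ = Submodule.span 𝒪[F] (Set.range ((g : Matrix (Fin 2) (Fin 2) F))ᵀ)) ∧
          Λ.map ((Matrix.toLin' ((γ : GL (Fin 2) F) : Matrix (Fin 2) (Fin 2) F)).restrictScalars 𝒪[F]) = Λ}.Finite ∧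
    {Λ : Submodule 𝒪[F] (Fin 2 → F) |
        ((∃ g : GL (Fin 2) F, (∃ J' ∈ glInt 2 F, (J' : Matrix (Fin 2) (Fin 2) F) = formCongr σ g J) ∧
            Λ = Submodule.span 𝒪[F] (Set.range ((g : Matrix (Fin 2) (Fin 2) F))ᵀ)) ∧
          Λ.map ((Matrix.toLin' ((γ : GL (Fin 2) F) : Matrix (Fin 2) (Fin 2) F)).restrictScalars 𝒪[F]) = Λ) ∧
        Λ.map ((Matrix.toLin' (((γ : GL (Fin 2) F) : Matrix (Fin 2) (Fin 2) F) - c • (1 : Matrix (Fin 2) (Fin 2) F))).restrictScalars 𝒪[F]) ≤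
          Λ.map ((Matrix.toLin' (ϖ ^ i • (1 : Matrix (Fin 2) (Fin 2) F))).restrictScalars 𝒪[F])}.ncard =
      ∑ j ∈ (range (N + 1)).filter (fun j => j % 2 = d ∧ j + i ≤ N), (if j = 0 then 1 else 2 * q ^ (j / 2)) ∧
    {Λ : Submodule 𝒪[F] (Fin 2 → F) |
        ((∃ g : GL (Fin 2) F, (∃ J' ∈ glInt 2 F, (J' : Matrix (Fin 2) (Fin 2) F) = formCongr σ g J) ∧
            Λ = Submodule.span 𝒪[F] (Set.range ((g : Matrix (Fin 2) (Fin 2) F))ᵀ)) ∧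
          Λ.map ((Matrix.toLin' ((γ : GL (Fin 2) F) : Matrix (Fin 2) (Fin 2) F)).restrictScalars 𝒪[F]) = Λ) ∧
        (Λ.map ((Matrix.toLin' (((γ : GL (Fin 2) F) : Matrix (Fin 2) (Fin 2) F) - c • (1 : Matrix (Fin 2) (Fin 2) F))).restrictScalars 𝒪[F]) ≤
          Λ.map ((Matrix.toLin' (ϖ ^ i • (1 : Matrix (Fin 2) (Fin 2) F))).restrictScalars 𝒪[F]) ∧
        ¬ Λ.map ((Matrix.toLin' (((γ : GL (Fin 2) F) : Matrix (Fin 2) (Fin 2) F) - c • (1 : Matrix (Fin 2) (Fin 2) F))).restrictScalars 𝒪[F]) ≤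
          Λ.map ((Matrix.toLin' (ϖ ^ (i + 1) • (1 : Matrix (Fin 2) (Fin 2) F))).restrictScalars 𝒪[F]))}.ncard =
      (if i ≤ N ∧ (N - i) % 2 = d then (if N - i = 0 then 1 else 2 * q ^ ((N - i) / 2)) else 0) := by
  have hlev := fun k => finite_and_ncard_selfDualStable_zpow_smul_diagonal_level_self hϖ σO hσO' hσσ hres h2 hσϖ hh0 hh1 hσh r hr hsq hd _ hQγ ha hc hN hq k
  -- (1) finiteness of `S(J, γ)`: transport and `S' = S'_0`
  have hfinS : {Λ : Submodule 𝒪[F] (Fin 2 → F) |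
        (∃ g : GL (Fin 2) F, (∃ J' ∈ glInt 2 F, (J' : Matrix (Fin 2) (Fin 2) F) = formCongr σ g J) ∧
            Λ = Submodule.span 𝒪[F] (Set.range ((g : Matrix (Fin 2) (Fin 2) F))ᵀ)) ∧
          Λ.map ((Matrix.toLin' ((γ : GL (Fin 2) F) : Matrix (Fin 2) (Fin 2) F)).restrictScalars 𝒪[F]) = Λ}.Finite := by
    refine finite_selfDualStable_of_congr σ J γ Q ?_
    rw [hform]
    exact (hlev 0).1.subset fun Λ hΛ => ⟨hΛ, map_sub_smul_one_le_pow_zero_of_map_eq hc (Q⁻¹ * γ * Q) Λ hΛ.2⟩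
  -- (2) the level-`k` counts transport
  have hcount : ∀ k, {Λ : Submodule 𝒪[F] (Fin 2 → F) |
        ((∃ g : GL (Fin 2) F, (∃ J' ∈ glInt 2 F, (J' : Matrix (Fin 2) (Fin 2) F) = formCongr σ g J) ∧
            Λ = Submodule.span 𝒪[F] (Set.range ((g : Matrix (Fin 2) (Fin 2) F))ᵀ)) ∧
          Λ.map ((Matrix.toLin' ((γ : GL (Fin 2) F) : Matrix (Fin 2) (Fin 2) F)).restrictScalars 𝒪[F]) = Λ) ∧
        Λ.map ((Matrix.toLin' (((γ : GL (Fin 2) F) : Matrix (Fin 2) (Fin 2) F) - c • (1 : Matrix (Fin 2) (Fin 2) F))).restrictScalars 𝒪[F]) ≤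
          Λ.map ((Matrix.toLin' (ϖ ^ k • (1 : Matrix (Fin 2) (Fin 2) F))).restrictScalars 𝒪[F])}.ncard =
      ∑ j ∈ (range (N + 1)).filter (fun j => j % 2 = d ∧ j + k ≤ N), (if j = 0 then 1 else 2 * q ^ (j / 2)) := fun k => by
    rw [ncard_selfDualStable_level_congr σ J γ Q c (ϖ ^ k), hform]
    exact (hlev k).2
  refine ⟨hfinS, hcount i, ?_⟩
  -- (3) exact depth = `S_i ∖ S_{i+1}`
  set Si := {Λ : Submodule 𝒪[F] (Fin 2 → F) |
        ((∃ g : GL (Fin 2) F, (∃ J' ∈ glInt 2 F, (J' : Matrix (Fin 2) (Fin 2) F) = formCongr σ g J) ∧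
            Λ = Submodule.span 𝒪[F] (Set.range ((g : Matrix (Fin 2) (Fin 2) F))ᵀ)) ∧
          Λ.map ((Matrix.toLin' ((γ : GL (Fin 2) F) : Matrix (Fin 2) (Fin 2) F)).restrictScalars 𝒪[F]) = Λ) ∧
        Λ.map ((Matrix.toLin' (((γ : GL (Fin 2) F) : Matrix (Fin 2) (Fin 2) F) - c • (1 : Matrix (Fin 2) (Fin 2) F))).restrictScalars 𝒪[F]) ≤
          Λ.map ((Matrix.toLin' (ϖ ^ i • (1 : Matrix (Fin 2) (Fin 2) F))).restrictScalars 𝒪[F])} with hSi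
  set Si1 := {Λ : Submodule 𝒪[F] (Fin 2 → F) |
        ((∃ g : GL (Fin 2) F, (∃ J' ∈ glInt 2 F, (J' : Matrix (Fin 2) (Fin 2) F) = formCongr σ g J) ∧
            Λ = Submodule.span 𝒪[F] (Set.range ((g : Matrix (Fin 2) (Fin 2) F))ᵀ)) ∧
          Λ.map ((Matrix.toLin' ((γ : GL (Fin 2) F) : Matrix (Fin 2) (Fin 2) F)).restrictScalars 𝒪[F]) = Λ) ∧
        Λ.map ((Matrix.toLin' (((γ : GL (Fin 2) F) : Matrix (Fin 2) (Fin 2) F) - c • (1 : Matrix (Fin 2) (Fin 2) F))).restrictScalars 𝒪[F]) ≤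
          Λ.map ((Matrix.toLin' (ϖ ^ (i + 1) • (1 : Matrix (Fin 2) (Fin 2) F))).restrictScalars 𝒪[F])} with hSi1
  have hsub : Si1 ⊆ Si := fun Λ hΛ => ⟨hΛ.1, map_le_map_pow_smul_one_of_succ hϖ.mem i _ Λ hΛ.2⟩
  have hsplit := Set.ncard_sdiff_add_ncard_of_subset hsub (hfinS.subset fun Λ hΛ => hΛ.1)
  have hi := hcount i
  have hi1 := hcount (i + 1)
  rw [sum_filter_mod_two_add_le_eq _ N d i] at hi
  rw [hi, hi1] at hsplit
  have hdiff : {Λ : Submodule 𝒪[F] (Fin 2 → F) |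
        ((∃ g : GL (Fin 2) F, (∃ J' ∈ glInt 2 F, (J' : Matrix (Fin 2) (Fin 2) F) = formCongr σ g J) ∧
            Λ = Submodule.span 𝒪[F] (Set.range ((g : Matrix (Fin 2) (Fin 2) F))ᵀ)) ∧
          Λ.map ((Matrix.toLin' ((γ : GL (Fin 2) F) : Matrix (Fin 2) (Fin 2) F)).restrictScalars 𝒪[F]) = Λ) ∧
        (Λ.map ((Matrix.toLin' (((γ : GL (Fin 2) F) : Matrix (Fin 2) (Fin 2) F) - c • (1 : Matrix (Fin 2) (Fin 2) F))).restrictScalars 𝒪[F]) ≤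
          Λ.map ((Matrix.toLin' (ϖ ^ i • (1 : Matrix (Fin 2) (Fin 2) F))).restrictScalars 𝒪[F]) ∧
        ¬ Λ.map ((Matrix.toLin' (((γ : GL (Fin 2) F) : Matrix (Fin 2) (Fin 2) F) - c • (1 : Matrix (Fin 2) (Fin 2) F))).restrictScalars 𝒪[F]) ≤
          Λ.map ((Matrix.toLin' (ϖ ^ (i + 1) • (1 : Matrix (Fin 2) (Fin 2) F))).restrictScalars 𝒪[F]))} = Si \ Si1 := by
    ext Λ
    simp only [hSi, hSi1, Set.mem_setOf_eq, Set.mem_sdiff, not_and]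
    exact ⟨fun h' => ⟨⟨h'.1, h'.2.1⟩, fun _ => h'.2.2⟩, fun h' => ⟨h'.1.1, h'.1.2, h'.2 h'.1.1⟩⟩
  rw [hdiff]
  omega

include hϖ hσO' hσσ hres h2 hσϖ hh0 hh1 hσh hr hsq hQγ ha hc hN in
/-- **THE `ϖ`-MODULAR COUNTS THROUGH A FRAME** (token `ϖ • ↑J′ = ᵗσ(g) J g`; `formCongr σ Q (ϖ⁻¹ • J) = ϖ^{−1} • diag h`, `Q⁻¹γQ = diag(a, c)`): `M(J, γ)` is FINITE, its level-`i`
subset has `ncard = Σ_{j ≤ N, j odd, j + i ≤ N} 2q^{⌊j∕2⌋}`, its exact-level-`i` subset `ncard = [i ≤ N ∧ N − i odd]·2q^{(N−i−1)∕2}` — `M(J) = S(ϖ⁻¹J)` (★ A-p03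
`setOf_modularStable_eq_selfDualStable` ∕ `…_and_eq_…_and`) + the self-dual frame lemma at `d = 1`. [cite: Kottwitz1988, §2] [cite: Jacobowitz1962, §8] -/
theorem finite_and_ncard_modularStable_of_diagonal_frame [IsDiscreteValuationRing 𝒪[F]] [Finite (ResidueField 𝒪[F])] {q : ℕ}
    (hq : Nat.card (ResidueField 𝒪[F]) = q) (hform1 : formCongr σ Q (ϖ⁻¹ • J) = ϖ ^ (-((1 : ℕ) : ℤ)) • Matrix.diagonal h) (i : ℕ) :
    {Λ : Submodule 𝒪[F] (Fin 2 → F) |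
        (∃ g : GL (Fin 2) F, (∃ J' ∈ glInt 2 F, ϖ • (J' : Matrix (Fin 2) (Fin 2) F) = formCongr σ g J) ∧
            Λ = Submodule.span 𝒪[F] (Set.range ((g : Matrix (Fin 2) (Fin 2) F))ᵀ)) ∧
          Λ.map ((Matrix.toLin' ((γ : GL (Fin 2) F) : Matrix (Fin 2) (Fin 2) F)).restrictScalars 𝒪[F]) = Λ}.Finite ∧
    {Λ : Submodule 𝒪[F] (Fin 2 → F) |
        ((∃ g : GL (Fin 2) F, (∃ J' ∈ glInt 2 F, ϖ • (J' : Matrix (Fin 2) (Fin 2) F) = formCongr σ g J) ∧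
            Λ = Submodule.span 𝒪[F] (Set.range ((g : Matrix (Fin 2) (Fin 2) F))ᵀ)) ∧
          Λ.map ((Matrix.toLin' ((γ : GL (Fin 2) F) : Matrix (Fin 2) (Fin 2) F)).restrictScalars 𝒪[F]) = Λ) ∧
        Λ.map ((Matrix.toLin' (((γ : GL (Fin 2) F) : Matrix (Fin 2) (Fin 2) F) - c • (1 : Matrix (Fin 2) (Fin 2) F))).restrictScalars 𝒪[F]) ≤
          Λ.map ((Matrix.toLin' (ϖ ^ i • (1 : Matrix (Fin 2) (Fin 2) F))).restrictScalars 𝒪[F])}.ncard =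
      ∑ j ∈ (range (N + 1)).filter (fun j => j % 2 = 1 ∧ j + i ≤ N), (if j = 0 then 1 else 2 * q ^ (j / 2)) ∧
    {Λ : Submodule 𝒪[F] (Fin 2 → F) |
        ((∃ g : GL (Fin 2) F, (∃ J' ∈ glInt 2 F, ϖ • (J' : Matrix (Fin 2) (Fin 2) F) = formCongr σ g J) ∧
            Λ = Submodule.span 𝒪[F] (Set.range ((g : Matrix (Fin 2) (Fin 2) F))ᵀ)) ∧
          Λ.map ((Matrix.toLin' ((γ : GL (Fin 2) F) : Matrix (Fin 2) (Fin 2) F)).restrictScalars 𝒪[F]) = Λ) ∧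
        (Λ.map ((Matrix.toLin' (((γ : GL (Fin 2) F) : Matrix (Fin 2) (Fin 2) F) - c • (1 : Matrix (Fin 2) (Fin 2) F))).restrictScalars 𝒪[F]) ≤
          Λ.map ((Matrix.toLin' (ϖ ^ i • (1 : Matrix (Fin 2) (Fin 2) F))).restrictScalars 𝒪[F]) ∧
        ¬ Λ.map ((Matrix.toLin' (((γ : GL (Fin 2) F) : Matrix (Fin 2) (Fin 2) F) - c • (1 : Matrix (Fin 2) (Fin 2) F))).restrictScalars 𝒪[F]) ≤
          Λ.map ((Matrix.toLin' (ϖ ^ (i + 1) • (1 : Matrix (Fin 2) (Fin 2) F))).restrictScalars 𝒪[F]))}.ncard =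
      (if i ≤ N ∧ (N - i) % 2 = 1 then (if N - i = 0 then 1 else 2 * q ^ ((N - i) / 2)) else 0) := by
  have h0 := hϖ.ne_zero
  rw [setOf_modularStable_eq_selfDualStable σ h0 J γ, setOf_modularStable_and_eq_selfDualStable_and σ h0 J γ,
    setOf_modularStable_and_eq_selfDualStable_and σ h0 J γ]
  exact finite_and_ncard_selfDualStable_of_diagonal_frame σ hϖ σO hσO' hσσ hres h2 hσϖ hh0 hh1 hσh r hr hsq le_rfl (ϖ⁻¹ • J) γ Q hQγ ha hc hN hform1 hq i

end OfFrame

end Literature.NumberTheory.Automorphic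

namespace Literature.NumberTheory.Automorphic.UnitaryGroup

open Literature.NumberTheory.Rogawski1990 Literature.NumberTheory.GaloisRepresentations Literature.NumberTheory.LocalFields

variable (L : Type) [Field L] [NumberField L] [IsCMField L] (v : HeightOneSpectrum (𝓞 ↥(maximalRealSubfield L)))
  (w : PlacesOver L v) (hw : IsCMField.complexConj L • w.1 = w.1)

/-! ## §1 Even orders of fixed elements and the diagonal unit frame at a tamely ramified `w` (the `σO` package is ★ A-p19 R-0c) -/

section Package

include hw in
/-- **σ_w-FIXED ELEMENTS HAVE EVEN ORDER at a tamely ramified place**: `σ_w r = r`, `r ≠ 0` ⇒ `Even (log v_w r)` — for an anti-fixed uniformiser `ϖ` (★ p04), `ϖ r` is anti-fixed,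
hence of ODD order (★ `odd_log_valued_of_galAdicCompletionMap_eq_neg`). [cite: Jacobowitz1962, §5] [cite: Rogawski1990, §3.5 p. 29] -/
theorem even_log_valued_of_galAdicCompletionMap_eq_of_ramified (he : v.asIdeal.ramificationIdx' w.1.asIdeal ≠ 1)
    (h2 : Valued.v (2 : w.1.adicCompletion L) = 1) {r : w.1.adicCompletion L}
    (hfix : galAdicCompletionMap (L := L) (IsCMField.complexConj L) hw r = r) (hr0 : r ≠ 0) : Even (WithZero.log (Valued.v r)) := by
  have hc1 : IsCMField.complexConj L ≠ 1 := IsCMField.complexConj_ne_one L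
  obtain ⟨ϖ, hϖv, hσϖ⟩ := exists_uniformizer_galAdicCompletionMap_eq_neg_of_ramified L (IsCMField.complexConj L) hc1 w hw he h2
  have hϖ0 : (ϖ : w.1.adicCompletion L) ≠ 0 := ϖ.ne_zero
  have hσ : galAdicCompletionMap (L := L) (IsCMField.complexConj L) hw ((ϖ : w.1.adicCompletion L) * r) = -((ϖ : w.1.adicCompletion L) * r) := by
    rw [map_mul, hσϖ, hfix, neg_mul]
  have hodd := odd_log_valued_of_galAdicCompletionMap_eq_neg L (IsCMField.complexConj L) hc1 w hw he h2 (mul_ne_zero hϖ0 hr0) hσ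
  rw [map_mul, WithZero.log_mul ((Valuation.ne_zero_iff _).2 hϖ0) ((Valuation.ne_zero_iff _).2 hr0), hϖv, WithZero.log_exp] at hodd
  obtain ⟨k, hk⟩ := hodd
  exact ⟨k + 1, by omega⟩

include hw in
/-- **RESCALING A σ_w-FIXED ELEMENT TO A UNIT** (ramified): `σ_w r = r`, `r ≠ 0` ⇒ `∃ c ≠ 0, v_w(σ_w(c) r c) = 1` (`log v_w r = 2m`, `c := ϖ^m` any uniformiser power:
`v_w(σ_w c) = v_w(c)`). [cite: Jacobowitz1962, §5, §8] [cite: Rogawski1990, §3.5 p. 29] -/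
theorem exists_valued_map_mul_mul_eq_one_of_ramified (he : v.asIdeal.ramificationIdx' w.1.asIdeal ≠ 1) (h2 : Valued.v (2 : w.1.adicCompletion L) = 1)
    {r : w.1.adicCompletion L} (hfix : galAdicCompletionMap (L := L) (IsCMField.complexConj L) hw r = r) (hr0 : r ≠ 0) :
    ∃ c : w.1.adicCompletion L, c ≠ 0 ∧ Valued.v (galAdicCompletionMap (L := L) (IsCMField.complexConj L) hw c * r * c) = 1 := by
  have hc1 : IsCMField.complexConj L ≠ 1 := IsCMField.complexConj_ne_one L
  obtain ⟨m, hm⟩ := even_log_valued_of_galAdicCompletionMap_eq_of_ramified L v w hw he h2 hfix hr0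
  obtain ⟨ϖ, hϖv, -⟩ := exists_uniformizer_galAdicCompletionMap_eq_neg_of_ramified L (IsCMField.complexConj L) hc1 w hw he h2
  have hϖ0 : (ϖ : w.1.adicCompletion L) ≠ 0 := ϖ.ne_zero
  have hvr0 : Valued.v r ≠ 0 := (Valuation.ne_zero_iff _).2 hr0
  refine ⟨(ϖ : w.1.adicCompletion L) ^ m, zpow_ne_zero _ hϖ0, ?_⟩
  rw [map_mul, map_mul, valued_galAdicCompletionMap, map_zpow₀, hϖv, ← WithZero.exp_log hvr0, hm, ← WithZero.exp_zsmul, ← WithZero.exp_add,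
    ← WithZero.exp_add, ← WithZero.exp_zero]
  congr 1; simp only [smul_eq_mul]; ring

include hw in
/-- **RESCALING AN EIGENFRAME TO A DIAGONAL UNIT GRAM MATRIX (ramified)**: `J` `σ_w`-hermitian with `det J ≠ 0`, `γ ∈ U(σ_w, J)` with an eigenframe `γ P = P · diag(u)`, `u₀ ≠ u₁`,
`σ_w(uᵢ) uᵢ = 1`: there are column scalars `c` (a diagonal `D`) and UNITS `h₀, h₁` (`v_w(hᵢ) = 1`, `σ_w hᵢ = hᵢ`) with `ᵗσ_w(P D) J (P D) = diag(h)` and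
`h₀ h₁ = σ_w(det(P D)) · det J · det(P D)` — `H_P` is diagonal with `σ_w`-fixed non-zero entries (★ `twistGram_eigenframe_eq_diagonal`), each of EVEN order, rescaled by a
uniformiser power (no parity bit survives, contrast ★ inert `exists_rescaling_formCongr_eq_uniformizer_pow_smul_one`). [cite: Rogawski1990, §3.5 p. 29; §4.9 Lemma 4.9.3 p. 56]
[cite: Jacobowitz1962, §8] -/
theorem exists_rescaling_formCongr_eq_diagonal_of_ramified (he : v.asIdeal.ramificationIdx' w.1.asIdeal ≠ 1) (h2 : Valued.v (2 : w.1.adicCompletion L) = 1)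
    {J : Matrix (Fin 2) (Fin 2) (w.1.adicCompletion L)} (hJ : (J.map (galAdicCompletionMap (L := L) (IsCMField.complexConj L) hw))ᵀ = J) (hJ0 : J.det ≠ 0)
    {γ P : GL (Fin 2) (w.1.adicCompletion L)} {u : Fin 2 → w.1.adicCompletion L}
    (hγ : γ ∈ Literature.AlgebraicGeometry.ShimuraVarieties.unitaryGroup (galAdicCompletionMap (L := L) (IsCMField.complexConj L) hw) J)
    (hP : (γ : Matrix (Fin 2) (Fin 2) (w.1.adicCompletion L)) * P = P * diagonal u) (hu : Function.Injective u)
    (hu1 : ∀ i, galAdicCompletionMap (L := L) (IsCMField.complexConj L) hw (u i) * u i = 1) :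
    ∃ (c : Fin 2 → w.1.adicCompletion L) (D : GL (Fin 2) (w.1.adicCompletion L)) (h : Fin 2 → w.1.adicCompletion L),
      (D : Matrix (Fin 2) (Fin 2) (w.1.adicCompletion L)) = diagonal c ∧ (∀ i, Valued.v (h i) = 1) ∧
      (∀ i, galAdicCompletionMap (L := L) (IsCMField.complexConj L) hw (h i) = h i) ∧
      formCongr (galAdicCompletionMap (L := L) (IsCMField.complexConj L) hw) (P * D) J = diagonal h ∧
      h 0 * h 1 = galAdicCompletionMap (L := L) (IsCMField.complexConj L) hw (P * D).val.det * J.det * (P * D).val.det := by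
  set σ := galAdicCompletionMap (L := L) (IsCMField.complexConj L) hw with hσ
  have hσσ : ∀ x, σ (σ x) = x :=
    galAdicCompletionMap_galAdicCompletionMap_of_smul_eq (IsCMField.complexConj L) w (IsCMField.complexConj_ne_one L) hw
  set d : Fin 2 → w.1.adicCompletion L := fun i => twistGram σ J P.val i i with hd
  have hHP : twistGram σ J P.val = diagonal d := twistGram_eigenframe_eq_diagonal σ J hγ hP hu hu1
  have hdfix : ∀ i, σ (d i) = d i := fun i => map_twistGram_apply_self σ J hσσ hJ P.val i
  have hd0 : ∀ i, d i ≠ 0 := fun i => twistGram_eigenframe_apply_ne_zero σ J hJ0 hγ hP hu hu1 i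
  obtain ⟨c₀, hc₀, hv₀⟩ := exists_valued_map_mul_mul_eq_one_of_ramified L v w hw he h2 (hdfix 0) (hd0 0)
  obtain ⟨c₁, hc₁, hv₁⟩ := exists_valued_map_mul_mul_eq_one_of_ramified L v w hw he h2 (hdfix 1) (hd0 1)
  have hcne : ∀ i, (![c₀, c₁] : Fin 2 → w.1.adicCompletion L) i ≠ 0 := fun i => by fin_cases i; exacts [hc₀, hc₁]
  have hDdet : (diagonal (![c₀, c₁] : Fin 2 → w.1.adicCompletion L)).det ≠ 0 := by
    rw [det_diagonal]; exact Finset.prod_ne_zero_iff.2 fun i _ => hcne i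
  let D : GL (Fin 2) (w.1.adicCompletion L) := Matrix.GeneralLinearGroup.mkOfDetNeZero _ hDdet
  have hD : (D : Matrix (Fin 2) (Fin 2) (w.1.adicCompletion L)) = diagonal ![c₀, c₁] := rfl
  have hPJ : formCongr σ P J = diagonal d := hHP
  have hform := formCongr_mul_diagonal_of_eq_diagonal σ P D J hPJ hD
  refine ⟨![c₀, c₁], D, fun i => σ ((![c₀, c₁] : Fin 2 → _) i) * d i * (![c₀, c₁] : Fin 2 → _) i, hD, fun i => ?_, fun i => ?_, hform, ?_⟩
  · fin_cases i; exacts [hv₀, hv₁]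
  · simp only [map_mul, hσσ, hdfix]; ring
  · have hdet := congrArg Matrix.det hform
    rw [det_diagonal, Fin.prod_univ_two] at hdet
    rw [← hdet]
    exact det_twistGram σ J (P * D).val

end Package

end Literature.NumberTheory.Automorphic.UnitaryGroup

end
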